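import Literature.AlgebraicGeometry.Motives.AbelianVarietyHomGaloisPoints
import Literature.AlgebraicGeometry.Motives.AbelianVarietyEndComplexGaloisTools
import Literature.AlgebraicGeometry.Motives.AbelianVarietyTorsionPointsAlgClosed
import Literature.AlgebraicGeometry.ComplexMultiplication.IdealSectionPointsFrobenius
import Literature.NumberTheory.DiophantineGeometry.AVIsogenyTate
import HarnessLib

/-!
# Homomorphisms `P_L → Q_L` through the biproduct `(P ⊞ Q)_L`: Galois conjugation, rigidity over `K̄`,
# `ℓ`-primary torsion rigidity, and the Frobenius sentence on complex torsion points (tools)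

Topic `Literature/AlgebraicGeometry/Motives`, namespace `Literature.AlgebraicGeometry.Motives.AbelianVariety`.
THEOREMS ONLY (no definition, no named fact, no instance; net Literature debt 0).  Tool layer for the cell
`hodgecm-mathlib` (D-0151) FLOOR-0 P5-W5 junction «two structures of type `(K, Φ)` over `k` with the SAME Frobenius
elements on their Tate modules are `k`-isogenous» ([Shimura1998] Lemma 19.12 read in the Frobenius currency of
Thm. 19.11 / [SerreTate1968] §7 Thm. 11), assembled in
`Literature.NumberTheory.ComplexMultiplication.HeckeCharacterIsogenyRationalFrobenius`.

The device of [Shimura1998] §1.2 / the tree's `homDefinedOverFiniteExtension_holds`: a homomorphism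
`r : P ⊗_K L → Q ⊗_K L` is the corner `R = (pr₁ ⊗ L) ≫ r ≫ (in₂ ⊗ L)` of an ENDOMORPHISM of `(P ⊞ Q) ⊗_K L`, and
`r = (in₁ ⊗ L) ≫ R ≫ (pr₂ ⊗ L)`; base changes of `K`-homomorphisms are Galois-fixed (`galConjHom_baseChange`) and Galois
conjugation is multiplicative (`galConjHom_comp`), so every statement about the `Aut(L/K)`-conjugates `σ • R`
(`AbelianVariety.galConj`, for which the tree has the full toolkit: `galConj_mul`, rigidity over `K̄`
`galConj_eq_self_of_forall_apply_algebraMap`, `pointsEnd_galConj`, Milne's Lemma 12.6) transfers to `σ • r`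
(`galConjHom`).

* §1 `inl_galConj_corner_snd` (`(in₁)_L ≫ σ • R ≫ (pr₂)_L = σ • r`), `galConj_corner` (`σ • R` is the corner of `σ • r`),
  **`galConj_corner_eq_iff`** (`σ • R = R ↔ σ • r = r`).
* §2 `galConjHom_mul` (`(στ) • r = σ • (τ • r)`), `galConjHom_one`; over `K ⊆ ℂ` of characteristic `0` with a
  `K`-embedding `K̄ → ℂ`: **`galConjHom_eq_self_of_forall_apply_algebraMap`** (an automorphism of `ℂ/K` fixing `K̄`
  pointwise fixes every `r`), `galConjHom_eq_galConjHom_of_forall_apply_algebraMap` (two automorphisms agreeing on `K̄`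
  conjugate `r` identically) — «`Hom_ℂ = Hom_{K̄}`», [Shimura1998] §1.2.
* §3 **`hom_eq_zero_of_forall_primaryTorsionPoints`**: over an algebraically closed field of characteristic `0`, a
  homomorphism killing `A[ℓⁿ](K)` for ALL `n` (ONE prime `ℓ`) is zero — it is divisible by every `ℓⁿ` in the free
  finitely generated `ℤ`-module `Hom(A, B)` ([Milne1986AbelianVarieties] Lemma 12.6 = the tree's
  `exists_eq_zsmul_of_forall_torsionPoints_self`, [MumfordAV1970] §19 Thm. 3).
* §4 **`tateRep_biprod_eq_tateModuleMap_map`**: if `σ ∈ Γ_K` acts on `T_ℓ A` as `T_ℓ(f)` and on `T_ℓ B` as `T_ℓ(g)`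
  then it acts on `T_ℓ(A ⊞ B)` as `T_ℓ(f ⊞ g)` (`biprod.total`, `Γ_K`-equivariance of `T_ℓ`).
* §5 **`smul_eq_map_of_forall_geomTorsion_complex`** / **`smul_eq_map_of_tateRep_eq_complex`**: if `τ ∈ Gal(k̄/k)`
  acts on the geometric `N`-torsion as an endomorphism `f` (e.g. `ρ_ℓ(τ) = T_ℓ(f)`, ★
  `smul_eq_geomPointsMap_of_tateRep_eq`), then every `σ ∈ Aut(ℂ/k)` extending `τ` along `e : k̄ → ℂ` acts on
  `A[N](ℂ)` as `f` — the torsion points are `k̄`-rational (★ `exists_extendScalars_eq_of_mem_torsionPoints`,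
  `AlgPoints.smul_extendScalars`); the converse direction is ★ `smul_eq_geomPointsMap_of_forall_torsionPoints_complex`.

## References
* [Shimura1998] G. Shimura, *Abelian Varieties with Complex Multiplication and Modular Functions* (1998), Ch. I §1.2
  (p. 4) («every element of `Hom(A,B)` is defined over a separably algebraic extension of `k`»); Thm. 19.11 (proof).
* [Milne1986AbelianVarieties] J. S. Milne, *Abelian Varieties* (Cornell–Silverman 1986), §12 Lemma 12.2, Lemma 12.6; §16.
* [MumfordAV1970] D. Mumford, *Abelian Varieties* (1970), §19 Thm. 3 and Cor. 1 (p. 176); §6 (p. 64).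
* [Milne2005ShimuraVarieties] J. S. Milne, *Introduction to Shimura Varieties* (2005/2017), §13 Prop. 13.1 (proof).
* [SerreTate1968] J.-P. Serre, J. Tate, *Good reduction of abelian varieties*, Ann. of Math. 88 (1968), §1 (p. 493).
* [GortzWedhorn2020] U. Görtz, T. Wedhorn, *Algebraic Geometry I* (2nd ed. 2020), §(14.20) (Galois action on `X_L`), Remark 16.54
  (base change of homomorphisms).
-/

noncomputable section

open CategoryTheory CategoryTheory.Limits AlgebraicGeometry
open scoped MonObj

universe u

namespace Literature.AlgebraicGeometry.Motives

namespace AbelianVariety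

set_option backward.isDefEq.respectTransparency false

/-! ## §1 The corner endomorphism of `(P ⊞ Q)_L` attached to `r : P_L → Q_L` -/

section Corner

variable {K : Type u} [Field K] (L : Type u) [Field L] [Algebra K L] (σ : L ≃ₐ[K] L)
  (P Q : AbelianVariety K)

/-- `(in₁)_L ≫ (pr₁)_L = 𝟙` (base change of homomorphisms is a functor, [GortzWedhorn2020] Remark 16.54; `biprod.inl_fst`).
[cite: GortzWedhorn2020, Remark 16.54 (base change of homomorphisms)] [cite: MumfordAV1970, §19 (p. 176)] -/
theorem baseChange_inl_comp_baseChange_fst :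
    Hom.baseChange L (biprod.inl : P ⟶ P ⊞ Q) ≫ Hom.baseChange L (biprod.fst : P ⊞ Q ⟶ P) = 𝟙 _ := by
  rw [← Hom.baseChange_comp, biprod.inl_fst, Hom.baseChange_id]

/-- `(in₂)_L ≫ (pr₂)_L = 𝟙` (base change of homomorphisms is a functor; `biprod.inr_snd`).
[cite: GortzWedhorn2020, Remark 16.54 (base change of homomorphisms)] [cite: MumfordAV1970, §19 (p. 176)] -/
theorem baseChange_inr_comp_baseChange_snd :
    Hom.baseChange L (biprod.inr : Q ⟶ P ⊞ Q) ≫ Hom.baseChange L (biprod.snd : P ⊞ Q ⟶ Q) = 𝟙 _ := by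
  rw [← Hom.baseChange_comp, biprod.inr_snd, Hom.baseChange_id]

/-- **`(in₁)_L ≫ σ • R ≫ (pr₂)_L = σ • r`** for the corner `R = (pr₁)_L ≫ r ≫ (in₂)_L ∈ End((P ⊞ Q)_L)` of
`r : P_L → Q_L`: Galois conjugation is multiplicative (`galConjHom_comp`) and fixes base changes
(`galConjHom_baseChange`). [cite: Shimura1998, Ch. I §1.2 (p. 4)] [cite: Milne2005ShimuraVarieties, §13 Prop. 13.1 (proof)] -/
theorem inl_galConj_corner_snd (r : P.baseChange L ⟶ Q.baseChange L) :
    Hom.baseChange L (biprod.inl : P ⟶ P ⊞ Q) ≫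
        (P ⊞ Q).galConj L σ (Hom.baseChange L (biprod.fst : P ⊞ Q ⟶ P) ≫ r ≫
          Hom.baseChange L (biprod.inr : Q ⟶ P ⊞ Q)) ≫
      Hom.baseChange L (biprod.snd : P ⊞ Q ⟶ Q) = galConjHom L σ P Q r := by
  rw [← galConjHom_eq_galConj, galConjHom_comp, galConjHom_comp, galConjHom_baseChange, galConjHom_baseChange,
    Category.assoc, Category.assoc, baseChange_inr_comp_baseChange_snd, Category.comp_id,
    ← Category.assoc, baseChange_inl_comp_baseChange_fst, Category.id_comp]

/-- **The conjugate of the corner is the corner of the conjugate**: `σ • ((pr₁)_L ≫ r ≫ (in₂)_L) =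
(pr₁)_L ≫ σ • r ≫ (in₂)_L`. [cite: Shimura1998, Ch. I §1.2 (p. 4)] [cite: Milne2005ShimuraVarieties, §13 Prop. 13.1 (proof)] -/
theorem galConj_corner (r : P.baseChange L ⟶ Q.baseChange L) :
    (P ⊞ Q).galConj L σ (Hom.baseChange L (biprod.fst : P ⊞ Q ⟶ P) ≫ r ≫
        Hom.baseChange L (biprod.inr : Q ⟶ P ⊞ Q)) =
      Hom.baseChange L (biprod.fst : P ⊞ Q ⟶ P) ≫ galConjHom L σ P Q r ≫
        Hom.baseChange L (biprod.inr : Q ⟶ P ⊞ Q) := by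
  rw [← galConjHom_eq_galConj, galConjHom_comp, galConjHom_comp, galConjHom_baseChange, galConjHom_baseChange]

/-- **`σ • R = R ↔ σ • r = r`** for the corner `R` of `r`. [cite: Shimura1998, Ch. I §1.2 (p. 4)]
[cite: Milne2005ShimuraVarieties, §13 Prop. 13.1 (proof)] -/
theorem galConj_corner_eq_iff (r : P.baseChange L ⟶ Q.baseChange L) :
    (P ⊞ Q).galConj L σ (Hom.baseChange L (biprod.fst : P ⊞ Q ⟶ P) ≫ r ≫
        Hom.baseChange L (biprod.inr : Q ⟶ P ⊞ Q)) =
      Hom.baseChange L (biprod.fst : P ⊞ Q ⟶ P) ≫ r ≫ Hom.baseChange L (biprod.inr : Q ⟶ P ⊞ Q) ↔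
    galConjHom L σ P Q r = r := by
  constructor
  · intro h
    rw [← inl_galConj_corner_snd L σ P Q r, h, Category.assoc, Category.assoc,
      baseChange_inr_comp_baseChange_snd, Category.comp_id, ← Category.assoc,
      baseChange_inl_comp_baseChange_fst, Category.id_comp]
  · intro h
    rw [galConj_corner, h]

end Corner

/-! ## §2 Galois conjugation of homomorphisms: group law and rigidity over `K̄` -/

section GroupLaw

variable {K : Type u} [Field K] (L : Type u) [Field L] [Algebra K L] (P Q : AbelianVariety K)

/-- **`(σ τ) • r = σ • (τ • r)`** for homomorphisms `r : P_L → Q_L` (the End form is `galConj_mul`; through the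
corner). [cite: GortzWedhorn2020, §(14.20)] -/
theorem galConjHom_mul (σ τ : L ≃ₐ[K] L) (r : P.baseChange L ⟶ Q.baseChange L) :
    galConjHom L (σ * τ) P Q r = galConjHom L σ P Q (galConjHom L τ P Q r) := by
  rw [← inl_galConj_corner_snd L (σ * τ) P Q r, galConj_mul, galConj_corner L τ, galConj_corner L σ,
    Category.assoc, Category.assoc, baseChange_inr_comp_baseChange_snd, Category.comp_id, ← Category.assoc,
    baseChange_inl_comp_baseChange_fst, Category.id_comp]

/-- `1 • r = r`. [cite: GortzWedhorn2020, §(14.20)] -/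
theorem galConjHom_one (r : P.baseChange L ⟶ Q.baseChange L) : galConjHom L 1 P Q r = r := by
  rw [← inl_galConj_corner_snd L 1 P Q r, galConj_one, Category.assoc, Category.assoc,
    baseChange_inr_comp_baseChange_snd, Category.comp_id, ← Category.assoc,
    baseChange_inl_comp_baseChange_fst, Category.id_comp]

/-- `σ⁻¹ • σ • r = r`. [cite: GortzWedhorn2020, §(14.20)] -/
theorem galConjHom_inv_galConjHom (σ : L ≃ₐ[K] L) (r : P.baseChange L ⟶ Q.baseChange L) :
    galConjHom L σ⁻¹ P Q (galConjHom L σ P Q r) = r := by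
  rw [← galConjHom_mul, inv_mul_cancel, galConjHom_one]

end GroupLaw

section Rigidity

variable {K : Type} [Field K] [CharZero K] [Algebra K ℂ] [Algebra (AlgebraicClosure K) ℂ]
  [IsScalarTower K (AlgebraicClosure K) ℂ] (P Q : AbelianVariety K)

/-- **An automorphism of `ℂ/K` fixing `K̄ ⊆ ℂ` pointwise fixes every homomorphism `P ⊗_K ℂ → Q ⊗_K ℂ`**
(«`Hom_ℂ = Hom_{K̄}`», [Shimura1998] §1.2; the End form ★ `galConj_eq_self_of_forall_apply_algebraMap` applied to the
corner in `End((P ⊞ Q) ⊗ ℂ)`). [cite: Shimura1998, Ch. I §1.2 (p. 4)] [cite: Milne1986AbelianVarieties, §12 Lemma 12.6] -/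
theorem galConjHom_eq_self_of_forall_apply_algebraMap (σ : ℂ ≃ₐ[K] ℂ)
    (hσ : ∀ x : AlgebraicClosure K, σ (algebraMap (AlgebraicClosure K) ℂ x) = algebraMap (AlgebraicClosure K) ℂ x)
    (r : P.baseChange ℂ ⟶ Q.baseChange ℂ) : galConjHom ℂ σ P Q r = r :=
  (galConj_corner_eq_iff ℂ σ P Q r).1 ((P ⊞ Q).galConj_eq_self_of_forall_apply_algebraMap σ hσ _)

/-- **Two automorphisms of `ℂ/K` with the same restriction to `K̄` conjugate homomorphisms `P ⊗ ℂ → Q ⊗ ℂ`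
identically.** [cite: Shimura1998, Ch. I §1.2 (p. 4)] [cite: Milne1986AbelianVarieties, §12 Lemma 12.6] -/
theorem galConjHom_eq_galConjHom_of_forall_apply_algebraMap (σ τ : ℂ ≃ₐ[K] ℂ)
    (h : ∀ x : AlgebraicClosure K, σ (algebraMap (AlgebraicClosure K) ℂ x) = τ (algebraMap (AlgebraicClosure K) ℂ x))
    (r : P.baseChange ℂ ⟶ Q.baseChange ℂ) : galConjHom ℂ σ P Q r = galConjHom ℂ τ P Q r := by
  rw [← inl_galConj_corner_snd ℂ σ P Q r, (P ⊞ Q).galConj_eq_galConj_of_forall_apply_algebraMap σ τ h,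
    inl_galConj_corner_snd]

end Rigidity

/-! ## §3 `ℓ`-primary torsion rigidity: a homomorphism killing every `A[ℓⁿ](K)` is zero -/

section Primary

/-- In a free `ℤ`-module an element divisible by every power of an integer `ℓ ≥ 2` is `0` (each coordinate in a
basis is an integer divisible by arbitrarily large powers of `ℓ`). [folklore] -/
private theorem eq_zero_of_forall_exists_pow_smul_eq {M : Type*} [AddCommGroup M] [Module.Free ℤ M]
    {ℓ : ℕ} (hℓ : 1 < ℓ) {x : M} (h : ∀ n : ℕ, ∃ y : M, x = ((ℓ : ℤ) ^ n) • y) : x = 0 := by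
  classical
  let b := Module.Free.chooseBasis ℤ M
  by_contra hx
  obtain ⟨i, hi⟩ : ∃ i, b.repr x i ≠ 0 := by
    by_contra h'
    push Not at h'
    exact hx (b.repr.injective (by ext i; rw [h' i, map_zero, Finsupp.zero_apply]))
  -- `ℓ ^ m ∣ c` with `m = |c|`, but `|c| < ℓ ^ |c|`
  obtain ⟨y, hy⟩ := h (b.repr x i).natAbs
  have hc : b.repr x i = (ℓ : ℤ) ^ (b.repr x i).natAbs * b.repr y i := by
    have h1 := congrArg (fun z => b.repr z i) hy
    simp only [map_smul, Finsupp.smul_apply, smul_eq_mul] at h1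
    exact h1
  have hdvd : ((ℓ : ℤ) ^ (b.repr x i).natAbs) ∣ b.repr x i := ⟨b.repr y i, hc⟩
  have hle : ℓ ^ (b.repr x i).natAbs ≤ (b.repr x i).natAbs := by
    have h1 := Int.natAbs_dvd_natAbs.mpr hdvd
    rw [Int.natAbs_pow, Int.natAbs_natCast] at h1
    exact Nat.le_of_dvd (Int.natAbs_pos.mpr hi) h1
  exact absurd hle (not_le.mpr (Nat.lt_pow_self hℓ))

variable {K : Type u} [Field K] [IsAlgClosed K] [CharZero K] {A B : AbelianVariety K}

/-- **A homomorphism killing all `ℓ`-primary torsion points is zero** (`K` algebraically closed of characteristic `0`,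
`ℓ ≥ 2`): if `φ(Q) = 0` for every `Q ∈ A[ℓⁿ](K)` and every `n`, then `φ = 0` — `φ` is divisible by every `ℓⁿ`
([Milne1986AbelianVarieties] Lemma 12.6, ★ `exists_eq_zsmul_of_forall_torsionPoints_self`) in the free `ℤ`-module
`Hom(A, B)` ([MumfordAV1970] §19 Thm. 3, ★ `module_free_hom_holds`).  (The all-`n` form is ★
`hom_eq_zero_of_forall_torsionPoints`; one prime suffices.)
[cite: Milne1986AbelianVarieties, §12 Lemma 12.6 (PDF p. 191)] [cite: MumfordAV1970, §19 Thm. 3 and Cor. 1 (p. 176)] -/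
theorem hom_eq_zero_of_forall_primaryTorsionPoints {ℓ : ℕ} (hℓ : 1 < ℓ) (φ : A ⟶ B)
    (hφ : ∀ n : ℕ, ∀ Q ∈ A.torsionPoints K ((ℓ : ℤ) ^ n),
      (Q ≫ φ.hom.hom.hom : Literature.AlgebraicGeometry.Motives.specOver K K ⟶ B.X) = 1) :
    φ = 0 := by
  haveI : Module.Free ℤ (A ⟶ B) := module_free_hom_holds A B
  refine eq_zero_of_forall_exists_pow_smul_eq hℓ fun n => ?_
  have hnK : (((ℓ : ℤ) ^ n : ℤ) : K) ≠ 0 := by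
    rw [Int.cast_pow, Int.cast_natCast]
    exact pow_ne_zero _ (Nat.cast_ne_zero.2 (by omega))
  exact exists_eq_zsmul_of_forall_torsionPoints_self ((ℓ : ℤ) ^ n) hnK φ (hφ n)

/-- **Two homomorphisms agreeing on all `ℓ`-primary torsion points are equal** (`K` algebraically closed of
characteristic `0`). [cite: Milne1986AbelianVarieties, §12 Lemma 12.6 (PDF p. 191)] [cite: MumfordAV1970, §19 Thm. 3 and Cor. 1 (p. 176)] -/
theorem hom_eq_of_forall_primaryTorsionPoints {ℓ : ℕ} (hℓ : 1 < ℓ) (f g : A ⟶ B)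
    (h : ∀ n : ℕ, ∀ Q ∈ A.torsionPoints K ((ℓ : ℤ) ^ n),
      (Q ≫ f.hom.hom.hom : Literature.AlgebraicGeometry.Motives.specOver K K ⟶ B.X) = Q ≫ g.hom.hom.hom) :
    f = g := by
  rw [← sub_eq_zero]
  refine hom_eq_zero_of_forall_primaryTorsionPoints hℓ (f - g) fun n Q hQ => ?_
  change Q ≫ (f.hom / g.hom).hom.hom = 1
  rw [Grp.Hom.hom_hom_div, GrpObj.comp_div, h n Q hQ, div_self']

end Primary

/-! ## §4 The Frobenius sentence on `T_ℓ(A ⊞ B)` -/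

section Biprod

variable {K : Type u} [Field K] (A B : AbelianVariety K) (ℓ : ℕ) [Fact ℓ.Prime]

/-- **`T_ℓ(A ⊞ B)`: if `σ ∈ Γ_K` acts on `T_ℓ A` as `T_ℓ(f)` and on `T_ℓ B` as `T_ℓ(g)`, it acts on `T_ℓ(A ⊞ B)` as
`T_ℓ(f ⊞ g)`** — every `x ∈ T_ℓ(A ⊞ B)` is `T_ℓ(in₁)(T_ℓ(pr₁) x) + T_ℓ(in₂)(T_ℓ(pr₂) x)` (`biprod.total`), `T_ℓ` of a
`K`-homomorphism is `Γ_K`-equivariant (`tateModuleMap_smul`), and `f ⊞ g = pr₁ ≫ f ≫ in₁ + pr₂ ≫ g ≫ in₂`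
(`biprod.map_eq`). [cite: MumfordAV1970, §19 (p. 176)] -/
theorem tateRep_biprod_eq_tateModuleMap_map (σ : Field.absoluteGaloisGroup K) (f : A ⟶ A) (g : B ⟶ B)
    (hA : A.tateRep ℓ σ = tateModuleMap ℓ f) (hB : B.tateRep ℓ σ = tateModuleMap ℓ g) :
    (A ⊞ B).tateRep ℓ σ = tateModuleMap ℓ (biprod.map f g) := by
  refine LinearMap.ext fun x => ?_
  have htot : x = tateModuleMap ℓ (biprod.inl : A ⟶ A ⊞ B) (tateModuleMap ℓ (biprod.fst : A ⊞ B ⟶ A) x) +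
      tateModuleMap ℓ (biprod.inr : B ⟶ A ⊞ B) (tateModuleMap ℓ (biprod.snd : A ⊞ B ⟶ B) x) := by
    have h := congrArg (fun φ => tateModuleMap ℓ φ x) (biprod.total : _ = 𝟙 (A ⊞ B))
    simp only [tateModuleMap_add, tateModuleMap_comp, tateModuleMap_id, LinearMap.add_apply, LinearMap.comp_apply,
      LinearMap.id_apply] at h
    exact h.symm
  conv_lhs => rw [htot]
  rw [map_add, ← tateModuleMap_smul (f := (biprod.inl : A ⟶ A ⊞ B)) (σ := σ),
    ← tateModuleMap_smul (f := (biprod.inr : B ⟶ A ⊞ B)) (σ := σ), hA, hB, biprod.map_eq, tateModuleMap_add,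
    tateModuleMap_comp, tateModuleMap_comp, tateModuleMap_comp, tateModuleMap_comp]
  rfl

end Biprod

/-! ## §5 From the Frobenius sentence on `A[N](k̄)` to the complex torsion points `A[N](ℂ)` -/

section Transfer

variable {k : Type} [Field k] [Algebra k ℂ] (A : AbelianVariety k)

/-- **The action of `Aut(ℂ/k)` on `A[N](ℂ)` is read on `A[N](k̄)`, endomorphism form.**  Let `e : k̄ → ℂ` be a
`k`-embedding and `σ ∈ Aut(ℂ/k)` an extension of `τ ∈ Gal(k̄/k)` along `e`.  If `τ` acts on the geometric `N`-torsion
`A[N](k̄)` as the endomorphism `f` of `A` and `N` is invertible in `k`, then `σ` acts on `A[N](ℂ)` as `f` — every complex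
torsion point is `k̄`-rational (★ `exists_extendScalars_eq_of_mem_torsionPoints`, [SerreTate1968] §1 «`A_m ⊂ A(K_s)`») and
extension of scalars is `Gal`- and `End`-equivariant (`AlgPoints.smul_extendScalars`).  Converse of ★
`smul_eq_geomPointsMap_of_forall_torsionPoints_complex`. [cite: SerreTate1968, §1 p. 493] [cite: Shimura1998, Thm. 19.11 proof («r(w)^σ = ι(β) r(w)»)] -/
theorem smul_eq_map_of_forall_geomTorsion_complex (e : AlgebraicClosure k →ₐ[k] ℂ) (σ : ℂ ≃ₐ[k] ℂ)
    (τ : Field.absoluteGaloisGroup k)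
    (hσ : ∀ x : AlgebraicClosure k, e (Field.absoluteGaloisGroup.toAlgEquiv k τ x) = σ (e x))
    (f : A ⟶ A) (N : ℤ) (hN : (N : k) ≠ 0)
    (h : ∀ P ∈ A.geomTorsion N, τ • P = AbelianVariety.Hom.geomPointsMap f P)
    {Q : A.Points ℂ} (hQ : Q ∈ A.torsionPoints ℂ N) : σ • Q = AlgPoints.map f.hom.hom.hom Q := by
  letI : Algebra (AlgebraicClosure k) ℂ := (e : AlgebraicClosure k →+* ℂ).toAlgebra
  haveI : IsScalarTower k (AlgebraicClosure k) ℂ := IsScalarTower.of_algebraMap_eq fun x => (e.commutes x).symm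
  obtain ⟨P₀, hP₀, rfl⟩ := A.exists_extendScalars_eq_of_mem_torsionPoints ℂ hN hQ
  have h1 : σ • AlgPoints.extendScalars A.X (AlgebraicClosure k) ℂ P₀ =
      AlgPoints.extendScalars A.X (AlgebraicClosure k) ℂ (Field.absoluteGaloisGroup.toAlgEquiv k τ • P₀) :=
    AlgPoints.smul_extendScalars A.X (Field.absoluteGaloisGroup.toAlgEquiv k τ) σ (fun x => (hσ x).symm) P₀
  have h2 : Field.absoluteGaloisGroup.toAlgEquiv k τ • P₀ = AlgPoints.map f.hom.hom.hom P₀ := by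
    have h3 := h (Additive.ofMul P₀) ((AbelianVariety.mem_geomTorsion_iff _).mpr hP₀)
    have h4 := congrArg Additive.toMul h3
    rw [AbelianVariety.toMul_smul, AbelianVariety.Hom.geomPointsMap_apply, AlgPoints.absoluteGaloisGroup_smul_def] at h4
    rw [AlgPoints.smul_def]
    exact h4
  rw [h1, h2, AlgPoints.extendScalars_apply, AlgPoints.extendScalars_apply, AlgPoints.map_apply, AlgPoints.map_apply,
    Category.assoc]

/-- **`ρ_ℓ(τ) = T_ℓ(f)` ⟹ every extension `σ ∈ Aut(ℂ/k)` of `τ` acts on `A[ℓⁿ](ℂ)` as `f`** (`k` of characteristic `0`):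
★ `smul_eq_geomPointsMap_of_tateRep_eq` ([Shimura1998] Thm. 19.11 proof read backwards) and §5's transfer.
[cite: Shimura1998, Thm. 19.11 proof («r(w)^σ = ι(β) r(w) for every w ∈ H_ℓ/𝔞»)] [cite: SerreTate1968, §1 p. 493] -/
theorem smul_eq_map_of_tateRep_eq_complex [CharZero k] (e : AlgebraicClosure k →ₐ[k] ℂ) (σ : ℂ ≃ₐ[k] ℂ)
    (τ : Field.absoluteGaloisGroup k)
    (hσ : ∀ x : AlgebraicClosure k, e (Field.absoluteGaloisGroup.toAlgEquiv k τ x) = σ (e x))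
    (ℓ : ℕ) [Fact ℓ.Prime] (f : A ⟶ A) (h : A.tateRep ℓ τ = tateModuleMap ℓ f) (n : ℕ)
    {Q : A.Points ℂ} (hQ : Q ∈ A.torsionPoints ℂ ((ℓ : ℤ) ^ n)) : σ • Q = AlgPoints.map f.hom.hom.hom Q := by
  have hℓ : (ℓ : k) ≠ 0 := Nat.cast_ne_zero.mpr (Fact.out : ℓ.Prime).ne_zero
  have hN : (((ℓ : ℤ) ^ n : ℤ) : k) ≠ 0 := by
    rw [Int.cast_pow, Int.cast_natCast]; exact pow_ne_zero _ hℓ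
  refine A.smul_eq_map_of_forall_geomTorsion_complex e σ τ hσ f _ hN (fun P hP => ?_) hQ
  have hP' : P ∈ A.geomTorsion (ℓ ^ n : ℕ) := by
    rw [Nat.cast_pow]; exact hP
  exact Literature.AlgebraicGeometry.ComplexMultiplication.smul_eq_geomPointsMap_of_tateRep_eq hℓ h n hP'

end Transfer

end AbelianVariety

end Literature.AlgebraicGeometry.Motives

end
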